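import Mathlib.Analysis.Calculus.MeanValue
import Mathlib.Analysis.Calculus.UniformLimitsDeriv
import Summits.NavierStokesRegularity.NavierStokesRegularity.Theorems.LerayQuarterDissipationFiniteDissipationLiouvilleEnvelopePackage
import HarnessLib

/-!
# Crux `FiniteDissipationLiouville` (stmt-NavierStokesRegularity-22144), line `birth`:
# the FINAL DATUM of the critical element is a `C¹` PROFILE OFF THE APEX in the homogeneous class

Theorems file of route `LerayQuarterDissipation` (lead ns-lqd-lead g7), `--supports 22144`.
Navier–Stokes regularity is NOT proved by anything here; no summit is.

The critical element carries the envelope `‖W(t,x)‖ ≤ A/(‖x‖+√(−t))`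
(`Envelope.envelope_of_minimal`) and the all-orders package `ScaleInvariantBounds W Q`
(`Envelope.scaleInvariantBounds_of_minimal`: `‖∇ⁿW‖ ≤ L_n/(‖x‖+√(−t))^{1+n}`,
`‖∂ₜ∇ⁿW‖ ≤ L_n/(‖x‖+√(−t))^{3+n}`). Off the apex the time derivative is bounded up to the
singular time, so the slices converge WITH THEIR GRADIENTS at the rate `(−t)`:
* `exists_limit_of_norm_deriv_le` — a curve in a complete space, differentiable on `(−∞,0)`
  with `‖g'‖ ≤ M`, has a limit `a` at `0⁻` with `‖g(t) − a‖ ≤ M(−t)` (mean value + completeness);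
* `exists_finalDatum_profile` — `u₀ : ℝ³ → ℝ³`, `Du₀ : ℝ³ → (ℝ³ →L ℝ³)` with, for `x ≠ 0`, `t < 0`:
  `‖W(t,x) − u₀(x)‖ ≤ L₀(−t)/‖x‖³`, `‖u₀(x)‖ ≤ A/‖x‖`, `‖∇W(t,x) − Du₀(x)‖ ≤ L₁(−t)/‖x‖⁴`,
  `‖Du₀(x)‖ ≤ L₁/‖x‖²`, `HasFDerivAt u₀ (Du₀ x) x`, `div u₀(x) = 0`: the final datum is a `C¹`
  divergence-free field on `ℝ³ ∖ {0}` in the (−1)-HOMOGENEOUS SYMBOL CLASS, attained uniformly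
  with gradients off every ball at the parabolic rate;
* `tendsto_pairing_of_rate` — for test fields supported off the apex the distributional trace of
  leads g3–g6 IS `∫⟪u₀, ψ⟫`, so every trace clause of the skeleton (`L³`/weighted/rotational
  floors on punctured balls and far fields) is a statement about this `C¹` profile;
* `finalDatum_profile_of_minimal` — packaged for the critical element.
PORTRAIT: off the apex the counterexample's final datum lies exactly in the Bradshaw–Tsai /
Chae–Wolf DSS-data class (`C¹_loc(ℝ³∖{0})`, divergence free, `O(‖x‖⁻¹)`, gradient `O(‖x‖⁻²)`),
for the WANDERING stratum as well; only discrete homogeneity (`…TraceDss`) distinguishes the DSS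
sub-case. Census: `C^∞` with all symbol bounds follows the same way from the higher clauses (not
typed); real-analyticity of `u₀` off the apex (shape (B′)) would need a uniform analyticity radius
up to `t = 0` (Kahane 1969), not in the tree. No definitions; standard axioms.
-/

noncomputable section

-- the summit and its single sub-problem share the name (CONVENTIONS §1), as in every Theorems file
set_option linter.dupNamespace false

namespace Summit.NavierStokesRegularity.NavierStokesRegularity.Theorems.FiniteDissipationLiouville.FinalDatum

open MeasureTheory Set Filter Topology Metric Function
open Literature.Analysis Literature.Analysis.FluidPDE
open Summit.NavierStokesRegularity.NavierStokesRegularity.Theorems.FiniteDissipationLiouville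
open Summit.NavierStokesRegularity.NavierStokesRegularity.Theorems
open scoped ENNReal NNReal RealInnerProductSpace

/-! ### The real-variable tool -/

/-- **A curve with bounded derivative on `(−∞,0)` has a limit at `0⁻`, attained at the linear
rate.** If `g : ℝ → F` (complete) is differentiable at every `s < 0` with `‖g'(s)‖ ≤ M`, there is
`a` with `‖g t − a‖ ≤ M(−t)` for all `t < 0`. -/
theorem exists_limit_of_norm_deriv_le {F : Type*} [NormedAddCommGroup F] [NormedSpace ℝ F]
    [CompleteSpace F] {g : ℝ → F} {M : ℝ}
    (hdiff : ∀ s : ℝ, s < 0 → DifferentiableAt ℝ g s) (hbd : ∀ s : ℝ, s < 0 → ‖deriv g s‖ ≤ M) :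
    ∃ a : F, ∀ t : ℝ, t < 0 → ‖g t - a‖ ≤ M * (-t) := by
  have hM : 0 ≤ M := (norm_nonneg _).trans (hbd (-1) (by norm_num))
  have hlip : ∀ x : ℝ, x < 0 → ∀ y : ℝ, y < 0 → ‖g y - g x‖ ≤ M * ‖y - x‖ := fun x hx y hy =>
    (convex_Iio (0 : ℝ)).norm_image_sub_le_of_norm_deriv_le (fun s hs => hdiff s hs)
      (fun s hs => hbd s hs) hx hy
  set τ : ℕ → ℝ := fun n => -(1 / ((n : ℝ) + 1)) with hτ
  have hτneg : ∀ n, τ n < 0 := fun n => by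
    have : (0 : ℝ) < 1 / ((n : ℝ) + 1) := by positivity
    show -(1 / ((n : ℝ) + 1)) < 0
    linarith
  have hτt : Tendsto τ atTop (𝓝 0) := by
    have h := (tendsto_one_div_add_atTop_nhds_zero_nat (𝕜 := ℝ)).neg
    rw [neg_zero] at h
    exact h
  have hτabs : ∀ n, |τ n| ≤ 1 / ((n : ℝ) + 1) := fun n => by
    show |-(1 / ((n : ℝ) + 1))| ≤ _
    rw [abs_neg, abs_of_pos (by positivity)]
  have hcau : CauchySeq fun n => g (τ n) := by
    refine Metric.cauchySeq_iff'.2 fun ε hε => ?_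
    obtain ⟨N, hN⟩ := exists_nat_gt (2 * M / ε)
    refine ⟨N, fun n hn => ?_⟩
    rw [dist_eq_norm]
    have h1 := hlip (τ N) (hτneg N) (τ n) (hτneg n)
    have h2 : ‖τ n - τ N‖ ≤ 2 * (1 / ((N : ℝ) + 1)) := by
      rw [Real.norm_eq_abs]
      calc |τ n - τ N| ≤ |τ n| + |τ N| := abs_sub _ _
        _ ≤ 1 / ((n : ℝ) + 1) + 1 / ((N : ℝ) + 1) := add_le_add (hτabs n) (hτabs N)
        _ ≤ 1 / ((N : ℝ) + 1) + 1 / ((N : ℝ) + 1) := by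
          gcongr
        _ = 2 * (1 / ((N : ℝ) + 1)) := by ring
    have hN1 : 0 < (N : ℝ) + 1 := by positivity
    have h3 : M * (2 * (1 / ((N : ℝ) + 1))) < ε := by
      rw [show M * (2 * (1 / ((N : ℝ) + 1))) = (2 * M) / ((N : ℝ) + 1) by ring]
      rw [div_lt_iff₀ hN1]
      have : 2 * M / ε < (N : ℝ) + 1 := by linarith
      rw [div_lt_iff₀ hε] at this
      linarith
    calc ‖g (τ n) - g (τ N)‖ ≤ M * ‖τ n - τ N‖ := h1
      _ ≤ M * (2 * (1 / ((N : ℝ) + 1))) := by gcongr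
      _ < ε := h3
  obtain ⟨a, ha⟩ := cauchySeq_tendsto_of_complete hcau
  refine ⟨a, fun t ht => ?_⟩
  have hlim1 : Tendsto (fun n => ‖g t - g (τ n)‖) atTop (𝓝 ‖g t - a‖) :=
    (tendsto_const_nhds.sub ha).norm
  have hlim2 : Tendsto (fun n => M * ‖τ n - t‖) atTop (𝓝 (M * (-t))) := by
    have : Tendsto (fun n => ‖τ n - t‖) atTop (𝓝 ‖(0 : ℝ) - t‖) :=
      (hτt.sub tendsto_const_nhds).norm
    rw [zero_sub, norm_neg, Real.norm_eq_abs, abs_of_neg ht] at this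
    exact this.const_mul M
  refine le_of_tendsto_of_tendsto' hlim1 hlim2 fun n => ?_
  have h := hlip (τ n) (hτneg n) t ht
  rwa [norm_sub_rev t (τ n)] at h

/-- Derivative of a curve composed with a linear isometry equivalence: the norm is unchanged. -/
theorem norm_deriv_linearIsometryEquiv_comp {F F' : Type*} [NormedAddCommGroup F]
    [NormedSpace ℝ F] [NormedAddCommGroup F'] [NormedSpace ℝ F'] (Φ : F ≃ₗᵢ[ℝ] F')
    {h : ℝ → F} {s : ℝ} (hh : DifferentiableAt ℝ h s) :
    ‖deriv (fun r => Φ (h r)) s‖ = ‖deriv h s‖ := by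
  have key : HasDerivAt (fun r => Φ (h r)) (Φ (deriv h s)) s := by
    have h1 := (Φ.toContinuousLinearEquiv : F →L[ℝ] F').hasFDerivAt.comp_hasDerivAt s
      hh.hasDerivAt
    exact h1
  rw [key.deriv, LinearIsometryEquiv.norm_map]

/-! ### The final datum off the apex -/

variable {C A : ℝ} {W : ℝ → EuclideanSpace ℝ (Fin 3) → EuclideanSpace ℝ (Fin 3)}
  {Q : ℝ → EuclideanSpace ℝ (Fin 3) → ℝ}

/-- Time-differentiability of values and gradients at a fixed point (joint smoothness). -/
theorem differentiableAt_slice_and_fderiv (hW : IsTypeIAncientMild C W)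
    (x : EuclideanSpace ℝ (Fin 3)) {s : ℝ} (hs : s < 0) :
    DifferentiableAt ℝ (fun r => W r x) s ∧ DifferentiableAt ℝ (fun r => fderiv ℝ (W r) x) s := by
  have hopen : IsOpen (Iio (0 : ℝ) ×ˢ (univ : Set (EuclideanSpace ℝ (Fin 3)))) :=
    isOpen_Iio.prod isOpen_univ
  have hat : ContDiffAt ℝ (⊤ : ℕ∞) (uncurry W) (s, x) :=
    hW.contDiffOn.contDiffAt (hopen.mem_nhds (mk_mem_prod hs (mem_univ _)))
  constructor
  · have h1 : ContDiffAt ℝ (⊤ : ℕ∞) (fun r : ℝ => uncurry W (r, x)) s :=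
      hat.comp s (contDiffAt_id.prodMk contDiffAt_const)
    exact h1.differentiableAt (by simp)
  · have h1 : ContDiffAt ℝ 1 (fun r : ℝ => fderiv ℝ (W r) x) s :=
      ContDiffAt.fderiv (f := W) (g := fun _ : ℝ => x) (n := (⊤ : ℕ∞)) hat contDiffAt_const
        (WithTop.coe_le_coe.2 le_top)
    exact h1.differentiableAt one_ne_zero

/-- **The final datum of an enveloped Type-I ancient mild field with the scale-invariant package
is a `C¹` divergence-free profile off the apex in the homogeneous symbol class, attained with
gradients at the parabolic rate.** -/
theorem exists_finalDatum_profile (hW : IsTypeIAncientMild C W) (hA : HasTypeIDecay A W)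
    (hS : RellichScarScarRigidity.ScaleInvariantBounds W Q) :
    ∃ (u₀ : EuclideanSpace ℝ (Fin 3) → EuclideanSpace ℝ (Fin 3))
      (Du₀ : EuclideanSpace ℝ (Fin 3) → ((EuclideanSpace ℝ (Fin 3)) →L[ℝ] (EuclideanSpace ℝ (Fin 3))))
      (L₀ L₁ : ℝ), 0 ≤ L₀ ∧ 0 ≤ L₁ ∧
      (∀ x : EuclideanSpace ℝ (Fin 3), x ≠ 0 → ∀ t : ℝ, t < 0 →
        ‖W t x - u₀ x‖ ≤ L₀ * (-t) / ‖x‖ ^ 3) ∧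
      (∀ x : EuclideanSpace ℝ (Fin 3), x ≠ 0 → ‖u₀ x‖ ≤ A / ‖x‖) ∧
      (∀ x : EuclideanSpace ℝ (Fin 3), x ≠ 0 → ∀ t : ℝ, t < 0 →
        ‖fderiv ℝ (W t) x - Du₀ x‖ ≤ L₁ * (-t) / ‖x‖ ^ 4) ∧
      (∀ x : EuclideanSpace ℝ (Fin 3), x ≠ 0 → ‖Du₀ x‖ ≤ L₁ / ‖x‖ ^ 2) ∧
      (∀ x : EuclideanSpace ℝ (Fin 3), x ≠ 0 → HasFDerivAt u₀ (Du₀ x) x) ∧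
      (∀ x : EuclideanSpace ℝ (Fin 3), x ≠ 0 → VectorCalculus.divergence u₀ x = 0) := by
  obtain ⟨L₀, hL₀⟩ := hS 0
  obtain ⟨L₁, hL₁⟩ := hS 1
  have hden : ∀ {t : ℝ}, t < 0 → ∀ x : EuclideanSpace ℝ (Fin 3), 0 < ‖x‖ + Real.sqrt (-t) :=
    fun {t} ht x => add_pos_of_nonneg_of_pos (norm_nonneg _) (Real.sqrt_pos.2 (neg_pos.2 ht))
  have hL₀nn : 0 ≤ L₀ := by
    have h := (norm_nonneg _).trans (hL₀ (-1) (by norm_num) 0).1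
    simpa using h
  have hL₁nn : 0 ≤ L₁ := by
    have h := (norm_nonneg _).trans (hL₁ (-1) (by norm_num) 0).1
    simpa using h
  have hAnn : 0 ≤ A := by
    have h := (norm_nonneg _).trans (hA (-1) (by norm_num) 0)
    simpa using h
  have hwt : ∀ {L : ℝ}, 0 ≤ L → ∀ (k : ℕ) {t : ℝ}, t < 0 → ∀ {x : EuclideanSpace ℝ (Fin 3)},
      x ≠ 0 → L / (‖x‖ + Real.sqrt (-t)) ^ k ≤ L / ‖x‖ ^ k := by
    intro L hL k t ht x hx
    have hxpos : 0 < ‖x‖ := norm_pos_iff.2 hx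
    exact div_le_div_of_nonneg_left hL (pow_pos hxpos k)
      (pow_le_pow_left₀ hxpos.le (le_add_of_nonneg_right (Real.sqrt_nonneg _)) k)
  -- values and gradients: limits with the rates `L₀(−t)/‖x‖³`, `L₁(−t)/‖x‖⁴`
  have hg : ∀ x : EuclideanSpace ℝ (Fin 3), x ≠ 0 → ∃ a : EuclideanSpace ℝ (Fin 3),
      ∀ t : ℝ, t < 0 → ‖W t x - a‖ ≤ L₀ / ‖x‖ ^ 3 * (-t) := by
    intro x hx
    refine exists_limit_of_norm_deriv_le
      (fun s hs => (differentiableAt_slice_and_fderiv hW x hs).1) fun s hs => ?_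
    have e : (fun r => iteratedFDeriv ℝ 0 (W r) x) = fun r =>
        (continuousMultilinearCurryFin0 ℝ (EuclideanSpace ℝ (Fin 3)) (EuclideanSpace ℝ (Fin 3))).symm
          (W r x) := by
      funext r
      rfl
    have h3 := (hL₀ s hs x).2.2
    rw [e, norm_deriv_linearIsometryEquiv_comp _ (differentiableAt_slice_and_fderiv hW x hs).1]
      at h3
    exact h3.trans (hwt hL₀nn 3 hs hx)
  choose! u₀ hu₀ using hg
  have hG : ∀ x : EuclideanSpace ℝ (Fin 3), x ≠ 0 →
      ∃ T : (EuclideanSpace ℝ (Fin 3)) →L[ℝ] (EuclideanSpace ℝ (Fin 3)),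
        ∀ t : ℝ, t < 0 → ‖fderiv ℝ (W t) x - T‖ ≤ L₁ / ‖x‖ ^ 4 * (-t) := by
    intro x hx
    refine exists_limit_of_norm_deriv_le
      (fun s hs => (differentiableAt_slice_and_fderiv hW x hs).2) fun s hs => ?_
    have e : (fun r => iteratedFDeriv ℝ 1 (W r) x) = fun r =>
        (continuousMultilinearCurryFin1 ℝ (EuclideanSpace ℝ (Fin 3)) (EuclideanSpace ℝ (Fin 3))).symm
          (fderiv ℝ (W r) x) := by
      funext r
      ext m i
      simp [iteratedFDeriv_one_apply, continuousMultilinearCurryFin1_symm_apply]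
    have h3 := (hL₁ s hs x).2.2
    rw [e, norm_deriv_linearIsometryEquiv_comp _ (differentiableAt_slice_and_fderiv hW x hs).2]
      at h3
    exact h3.trans (hwt hL₁nn 4 hs hx)
  choose! Du₀ hDu₀ using hG
  -- the slices `t_n = −1/(n+1)` and the two pointwise limits
  set τ : ℕ → ℝ := fun n => -(1 / ((n : ℝ) + 1)) with hτ
  have hτneg : ∀ n, τ n < 0 := fun n => by
    have : (0 : ℝ) < 1 / ((n : ℝ) + 1) := by positivity
    show -(1 / ((n : ℝ) + 1)) < 0
    linarith
  have hτt : Tendsto (fun n : ℕ => -τ n) atTop (𝓝 0) := by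
    have h := tendsto_one_div_add_atTop_nhds_zero_nat (𝕜 := ℝ)
    refine h.congr fun n => ?_
    show 1 / ((n : ℝ) + 1) = -(-(1 / ((n : ℝ) + 1)))
    rw [neg_neg]
  have hlimW : ∀ x : EuclideanSpace ℝ (Fin 3), x ≠ 0 →
      Tendsto (fun n => W (τ n) x) atTop (𝓝 (u₀ x)) := by
    intro x hx
    rw [tendsto_iff_norm_sub_tendsto_zero]
    refine squeeze_zero (fun n => norm_nonneg _) (fun n => hu₀ x hx (τ n) (hτneg n)) ?_
    simpa using hτt.const_mul (L₀ / ‖x‖ ^ 3)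
  have hlimD : ∀ x : EuclideanSpace ℝ (Fin 3), x ≠ 0 →
      Tendsto (fun n => fderiv ℝ (W (τ n)) x) atTop (𝓝 (Du₀ x)) := by
    intro x hx
    rw [tendsto_iff_norm_sub_tendsto_zero]
    refine squeeze_zero (fun n => norm_nonneg _) (fun n => hDu₀ x hx (τ n) (hτneg n)) ?_
    simpa using hτt.const_mul (L₁ / ‖x‖ ^ 4)
  -- differentiability of `u₀` off the apex with derivative `Du₀`
  have hderiv : ∀ x₀ : EuclideanSpace ℝ (Fin 3), x₀ ≠ 0 → HasFDerivAt u₀ (Du₀ x₀) x₀ := by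
    intro x₀ hx₀
    have hx₀pos : 0 < ‖x₀‖ := norm_pos_iff.2 hx₀
    set S : Set (EuclideanSpace ℝ (Fin 3)) := {y | ‖x₀‖ / 2 < ‖y‖} with hSdef
    have hSopen : IsOpen S := isOpen_lt continuous_const continuous_norm
    have hx₀S : x₀ ∈ S := by
      show ‖x₀‖ / 2 < ‖x₀‖
      linarith
    have hSne : ∀ y ∈ S, y ≠ 0 := fun y (hy : ‖x₀‖ / 2 < ‖y‖) h0 => by
      rw [h0, norm_zero] at hy; linarith
    have hSinv : ∀ y ∈ S, L₁ / ‖y‖ ^ 4 ≤ L₁ / (‖x₀‖ / 2) ^ 4 := fun y (hy : ‖x₀‖ / 2 < ‖y‖) =>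
      div_le_div_of_nonneg_left hL₁nn (by positivity) (pow_le_pow_left₀ (by positivity) hy.le 4)
    refine hasFDerivAt_of_tendstoUniformlyOn hSopen (f := fun n => W (τ n))
      (f' := fun n y => fderiv ℝ (W (τ n)) y) (g := u₀) (g' := Du₀) (l := atTop) ?_ ?_ ?_ hx₀S
    · refine Metric.tendstoUniformlyOn_iff.2 fun ε hε => ?_
      have hB : Tendsto (fun n : ℕ => L₁ / (‖x₀‖ / 2) ^ 4 * (-τ n)) atTop (𝓝 0) := by
        simpa using hτt.const_mul (L₁ / (‖x₀‖ / 2) ^ 4)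
      filter_upwards [(tendsto_order.1 hB).2 ε hε] with n hn y hy
      rw [dist_eq_norm, norm_sub_rev]
      calc ‖fderiv ℝ (W (τ n)) y - Du₀ y‖ ≤ L₁ / ‖y‖ ^ 4 * (-τ n) := hDu₀ y (hSne y hy) (τ n) (hτneg n)
        _ ≤ L₁ / (‖x₀‖ / 2) ^ 4 * (-τ n) := by
          have : 0 ≤ -τ n := (neg_pos.2 (hτneg n)).le
          exact mul_le_mul_of_nonneg_right (hSinv y hy) this
        _ < ε := hn
    · intro n y _
      exact (((hW.contDiff_slice (hτneg n)).differentiable (by simp)).differentiableAt).hasFDerivAt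
    · intro y hy
      exact hlimW y (hSne y hy)
  refine ⟨u₀, Du₀, L₀, L₁, hL₀nn, hL₁nn, ?_, ?_, ?_, ?_, hderiv, ?_⟩
  · intro x hx t ht
    rw [mul_div_right_comm]
    exact hu₀ x hx t ht
  · -- the envelope passes to the limit
    intro x hx
    have hxpos : 0 < ‖x‖ := norm_pos_iff.2 hx
    refine le_of_tendsto (hlimW x hx).norm (Eventually.of_forall fun n => ?_)
    calc ‖W (τ n) x‖ ≤ A / (‖x‖ + Real.sqrt (-τ n)) := hA (τ n) (hτneg n) x
      _ ≤ A / ‖x‖ := div_le_div_of_nonneg_left hAnn hxpos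
          (le_add_of_nonneg_right (Real.sqrt_nonneg _))
  · intro x hx t ht
    rw [mul_div_right_comm]
    exact hDu₀ x hx t ht
  · -- the gradient envelope passes to the limit
    intro x hx
    refine le_of_tendsto (hlimD x hx).norm (Eventually.of_forall fun n => ?_)
    calc ‖fderiv ℝ (W (τ n)) x‖ = ‖iteratedFDeriv ℝ 1 (W (τ n)) x‖ := (norm_iteratedFDeriv_one _).symm
      _ ≤ L₁ / (‖x‖ + Real.sqrt (-τ n)) ^ (1 + 1) := (hL₁ (τ n) (hτneg n) x).1
      _ ≤ L₁ / ‖x‖ ^ 2 := hwt hL₁nn 2 (hτneg n) hx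
  · -- divergence free: the trace passes to the limit
    intro x hx
    let ψ : ((EuclideanSpace ℝ (Fin 3)) →L[ℝ] (EuclideanSpace ℝ (Fin 3))) →ₗ[ℝ] ℝ :=
      { toFun := fun T => LinearMap.trace ℝ (EuclideanSpace ℝ (Fin 3)) (T : (EuclideanSpace ℝ (Fin 3)) →ₗ[ℝ] (EuclideanSpace ℝ (Fin 3)))
        map_add' := fun T T' => by simp
        map_smul' := fun c T => by simp }
    have hψ : Continuous ψ := ψ.continuous_of_finiteDimensional
    have h1 : Tendsto (fun n => ψ (fderiv ℝ (W (τ n)) x)) atTop (𝓝 (ψ (Du₀ x))) :=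
      (hψ.tendsto _).comp (hlimD x hx)
    have h2 : ∀ n, ψ (fderiv ℝ (W (τ n)) x) = 0 := fun n => hW.isDivFree (hτneg n) x
    simp_rw [h2] at h1
    have h3 : ψ (Du₀ x) = 0 := (tendsto_nhds_unique tendsto_const_nhds h1).symm
    show LinearMap.trace ℝ _ (fderiv ℝ u₀ x : (EuclideanSpace ℝ (Fin 3)) →ₗ[ℝ] (EuclideanSpace ℝ (Fin 3))) = 0
    rw [(hderiv x hx).fderiv]
    exact h3

/-! ### The distributional trace off the apex is the profile -/

/-- **Off the apex, the distributional final datum IS the profile `u₀`.** If the slices converge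
to `u₀` at the rate `L₀(−t)/‖x‖³` off the apex (as in `exists_finalDatum_profile`) and the field
has the envelope `A`, then for every test field `ψ` supported outside a ball `B(0,r)`, `r > 0`,
`∫⟪W(t), ψ⟫ → ∫⟪u₀, ψ⟫` as `t → 0⁻` (dominated convergence with the bound `(A/r)‖ψ‖`). -/
theorem tendsto_pairing_of_rate {u₀ : EuclideanSpace ℝ (Fin 3) → EuclideanSpace ℝ (Fin 3)}
    {L₀ : ℝ} (hW : IsTypeIAncientMild C W) (hA : HasTypeIDecay A W)
    (hrate : ∀ x : EuclideanSpace ℝ (Fin 3), x ≠ 0 → ∀ t : ℝ, t < 0 →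
      ‖W t x - u₀ x‖ ≤ L₀ * (-t) / ‖x‖ ^ 3)
    {ψ : EuclideanSpace ℝ (Fin 3) → EuclideanSpace ℝ (Fin 3)}
    (hψ : FunctionSpaces.IsTestFunctionOn (⊤ : TopologicalSpace.Opens (EuclideanSpace ℝ (Fin 3))) ψ)
    {r : ℝ} (hr : 0 < r) (hsupp : ∀ x, ψ x ≠ 0 → r < ‖x‖) :
    Tendsto (fun t => ∫ x, ⟪W t x, ψ x⟫) (𝓝[<] 0) (𝓝 (∫ x, ⟪u₀ x, ψ x⟫)) := by
  have hAnn : 0 ≤ A := by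
    have h := (norm_nonneg _).trans (hA (-1) (by norm_num) 0)
    simpa using h
  have hψc : Continuous ψ := hψ.contDiff.continuous
  have hev : ∀ᶠ t in 𝓝[<] (0 : ℝ), t < 0 := eventually_mem_nhdsWithin
  refine tendsto_integral_filter_of_dominated_convergence (fun x => A / r * ‖ψ x‖) ?_ ?_ ?_ ?_
  · filter_upwards [hev] with t ht
    exact ((hW.continuous_slice ht).inner hψc).aestronglyMeasurable
  · filter_upwards [hev] with t ht
    refine Eventually.of_forall fun x => ?_
    by_cases hx : ψ x = 0
    · simp [hx]
    · have hxr : r < ‖x‖ := hsupp x hx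
      calc ‖⟪W t x, ψ x⟫‖ ≤ ‖W t x‖ * ‖ψ x‖ := norm_inner_le_norm _ _
        _ ≤ A / (‖x‖ + Real.sqrt (-t)) * ‖ψ x‖ :=
          mul_le_mul_of_nonneg_right (hA t ht x) (norm_nonneg _)
        _ ≤ A / r * ‖ψ x‖ := by
          refine mul_le_mul_of_nonneg_right ?_ (norm_nonneg _)
          exact div_le_div_of_nonneg_left hAnn hr
            (hxr.le.trans (le_add_of_nonneg_right (Real.sqrt_nonneg _)))
  · exact ((hψc.norm).integrable_of_hasCompactSupport hψ.hasCompactSupport.norm).const_mul _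
  · refine Eventually.of_forall fun x => ?_
    by_cases hx : ψ x = 0
    · simp [hx]
    · have hx0 : x ≠ 0 := by
        intro h0
        have := hsupp x hx
        rw [h0, norm_zero] at this
        linarith
      have hconv : Tendsto (fun t => W t x) (𝓝[<] 0) (𝓝 (u₀ x)) := by
        rw [tendsto_iff_norm_sub_tendsto_zero]
        have hb : Tendsto (fun t : ℝ => L₀ * (-t) / ‖x‖ ^ 3) (𝓝[<] 0) (𝓝 0) := by
          have hc : Continuous fun t : ℝ => L₀ * (-t) / ‖x‖ ^ 3 :=
            (continuous_const.mul continuous_neg).div_const _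
          have := hc.tendsto 0
          simp only [neg_zero, mul_zero, zero_div] at this
          exact this.mono_left nhdsWithin_le_nhds
        exact squeeze_zero' (Eventually.of_forall fun t => norm_nonneg _)
          (hev.mono fun t ht => hrate x hx0 t ht) hb
      exact hconv.inner tendsto_const_nhds

/-! ### Packaged for the critical element -/

/-- **The final datum of the CRITICAL ELEMENT is a `C¹` divergence-free profile off the apex in
the homogeneous symbol class, and it is the distributional trace there** (`K_c` minimal,
`w ∈ 𝒟_{C,K_c}` singular: the clauses of `exists_finalDatum_profile` with the envelope of
`Envelope.envelope_of_minimal` and the package of `Envelope.scaleInvariantBounds_of_minimal`, plus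
`∫⟪w(t),ψ⟫ → ∫⟪u₀,ψ⟫` for test fields supported off a ball around the apex). -/
theorem finalDatum_profile_of_minimal {Kc : ℝ}
    (hmin : ∀ K' : ℝ, K' < Kc → ∀ v : ℝ → EuclideanSpace ℝ (Fin 3) → EuclideanSpace ℝ (Fin 3),
      IsTypeIAncientMild C v →
      (∀ s : ℝ, s < 0 → ∫⁻ x, ‖fderiv ℝ (v s) x‖ₑ ^ 2 ≤ ENNReal.ofReal (K' / Real.sqrt (-s))) →
      ¬ (∀ r > 0, ∀ M : ℝ, ∃ t ∈ Set.Ioo (-(r ^ 2)) (0 : ℝ),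
        ∃ x ∈ Metric.ball (0 : EuclideanSpace ℝ (Fin 3)) r, M < ‖v t x‖))
    {w : ℝ → EuclideanSpace ℝ (Fin 3) → EuclideanSpace ℝ (Fin 3)} (hw : IsTypeIAncientMild C w)
    (hDw : ∀ s : ℝ, s < 0 → ∫⁻ x, ‖fderiv ℝ (w s) x‖ₑ ^ 2 ≤ ENNReal.ofReal (Kc / Real.sqrt (-s)))
    (hsw : ∀ r > 0, ∀ M : ℝ, ∃ t ∈ Set.Ioo (-(r ^ 2)) (0 : ℝ),
      ∃ x ∈ Metric.ball (0 : EuclideanSpace ℝ (Fin 3)) r, M < ‖w t x‖) :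
    ∃ (A L₀ L₁ : ℝ) (u₀ : EuclideanSpace ℝ (Fin 3) → EuclideanSpace ℝ (Fin 3))
      (Du₀ : EuclideanSpace ℝ (Fin 3) → ((EuclideanSpace ℝ (Fin 3)) →L[ℝ] (EuclideanSpace ℝ (Fin 3)))),
      0 ≤ A ∧ 0 ≤ L₀ ∧ 0 ≤ L₁ ∧ HasTypeIDecay A w ∧
      (∀ x : EuclideanSpace ℝ (Fin 3), x ≠ 0 → ∀ t : ℝ, t < 0 →
        ‖w t x - u₀ x‖ ≤ L₀ * (-t) / ‖x‖ ^ 3) ∧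
      (∀ x : EuclideanSpace ℝ (Fin 3), x ≠ 0 → ‖u₀ x‖ ≤ A / ‖x‖) ∧
      (∀ x : EuclideanSpace ℝ (Fin 3), x ≠ 0 → ∀ t : ℝ, t < 0 →
        ‖fderiv ℝ (w t) x - Du₀ x‖ ≤ L₁ * (-t) / ‖x‖ ^ 4) ∧
      (∀ x : EuclideanSpace ℝ (Fin 3), x ≠ 0 → ‖Du₀ x‖ ≤ L₁ / ‖x‖ ^ 2) ∧
      (∀ x : EuclideanSpace ℝ (Fin 3), x ≠ 0 → HasFDerivAt u₀ (Du₀ x) x) ∧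
      (∀ x : EuclideanSpace ℝ (Fin 3), x ≠ 0 → VectorCalculus.divergence u₀ x = 0) ∧
      (∀ (ψ : EuclideanSpace ℝ (Fin 3) → EuclideanSpace ℝ (Fin 3)) (r : ℝ), 0 < r →
        FunctionSpaces.IsTestFunctionOn (⊤ : TopologicalSpace.Opens (EuclideanSpace ℝ (Fin 3))) ψ →
        (∀ x, ψ x ≠ 0 → r < ‖x‖) →
        Tendsto (fun t => ∫ x, ⟪w t x, ψ x⟫) (𝓝[<] 0) (𝓝 (∫ x, ⟪u₀ x, ψ x⟫))) := by
  obtain ⟨A, hA0, hA⟩ := Envelope.envelope_of_minimal hmin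
  have hdec : HasTypeIDecay A w := hA w hw hDw hsw
  obtain ⟨Q, -, hS⟩ := Envelope.scaleInvariantBounds_of_minimal hmin hw hDw hsw
  obtain ⟨u₀, Du₀, L₀, L₁, hL₀, hL₁, hrate, henv, hgrate, hgenv, hderiv, hdiv⟩ :=
    exists_finalDatum_profile hw hdec hS
  exact ⟨A, L₀, L₁, u₀, Du₀, hA0, hL₀, hL₁, hdec, hrate, henv, hgrate, hgenv, hderiv, hdiv,
    fun ψ r hr hψ hsupp => tendsto_pairing_of_rate hw hdec hrate hψ hr hsupp⟩

end Summit.NavierStokesRegularity.NavierStokesRegularity.Theorems.FiniteDissipationLiouville.FinalDatum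

end
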